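import Summits.ResolutionOfSingularities.ResolutionOfSingularities.Theorems.FrobeniusLadderFRationalResolutionChartAlgebraFixedPoint
import HarnessLib

/-!
# Crux `FrobeniusLadder.FRationalResolution` (stmt-ResolutionOfSingularities-15317), line `redirect`,
# stub `stub_diagonalizableQuotientResolution` — **monomial ideal membership is combinatorial at the
# torus-fixed point of a chart algebra** (point-blow-up recursion for the surface case over arbitrary
# fields, memo MEMO-15317-leafhand2-g6 §3–§4: Kato's (6.1)-type statement TRANSPORTED from the log
# regular base point `𝔭` to the fixed prime `𝔓₀` of a blow-up chart, where log regularity is not known)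

Setting as in `…ChartAlgebraNormalForm` / `…ChartAlgebraFixedPoint`: a chart `φ : P → A` (`P ⊆ ℤⁿ`
finitely generated saturated, `A` Noetherian) log regular at `𝔭`, unit face `F_𝔭`, `L = ℤF_𝔭`; a chart
algebra `C = A[χ(Q)]` over it with (D), (K), (S); `𝔓` a prime of `C` over `𝔭` containing `χ(Q ∖ L)`.

* `mem_span_image_add_of_mem_ideal_span` — a `C`-ideal generated by chart elements `χ(T)` is the
  `A`-span of `χ(T + Q)`;
* `exists_finset_mul_eq_algebraMap_of_mem_span_image` — transfer of `A`-span relations to monomial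
  ideals of `A` (general-set form of `…ChartAlgebraNormalForm.exists_finset_mul_eq_algebraMap_of_mem_span`);
* **`exists_sub_sub_mem_span_of_mem_span_fixedPrime`** — THE STATEMENT: for `q ∈ Q` and `W ⊆ Q`, if
  `χ(q) ∈ (χ(w) : w ∈ W)·C_𝔓` then `q − w − s ∈ L` for some `w ∈ W`, `s ∈ Q`; i.e. at the fixed point
  monomial ideal membership is decided in the monoid `Q` modulo the unit face `Q ∩ L`, exactly as at a
  log regular point (`LogChart.exists_sub_sub_mem_span_faceMonoid_of_mem_span`, to which it is reduced:
  clear the denominator `u ∉ 𝔓`, put `u` in normal form `φ(f)u = a + y` with `a ∉ 𝔭`, push `y·χ(q)`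
  into the monomials `χ(q + (Q ∖ L))`, transfer to `A_𝔭`, and discard the spurious alternative
  `q ∈ q + (Q ∖ L) + Q` by (S)).

Use: embedding dimension of `C_𝔓₀` (the monomial generators of `𝔪_{C_𝔓₀} = I(𝔓₀, χ)` indexed by the
Hilbert basis of `Q/(Q ∩ L)` are minimal), hence the regularity test at the fixed points of the blown-up
charts. Honest label: generic local algebra toward ONE leaf stub (no stub, crux or summit closed). No
definitions, no named facts, no sorry. [cite: Kato1994, (6.1), (10.1)] [cite: Niziol2006, Lemma 2.4]
-/

noncomputable section

-- single-problem summit: the doubled namespace component is forced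
set_option linter.dupNamespace false

open IsLocalRing Literature.AlgebraicGeometry.Resolution Literature.AlgebraicGeometry.Resolution.LogChart
open Summit.ResolutionOfSingularities.ResolutionOfSingularities.Theorems.FRationalResolution.ChartAlgebraNormalForm
open Summit.ResolutionOfSingularities.ResolutionOfSingularities.Theorems.FRationalResolution.ChartAlgebraFixedPoint

namespace Summit.ResolutionOfSingularities.ResolutionOfSingularities.Theorems.FRationalResolution.ChartAlgebraFixedPointMembership

universe u

variable {A : Type u} [CommRing A] {n : ℕ} {P : AddSubmonoid (Fin n → ℤ)} {φ : Multiplicative P →* A}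
  {𝔭 : Ideal A} [𝔭.IsPrime] {C : Type u} [CommRing C] [Algebra A C] {Q : AddSubmonoid (Fin n → ℤ)}
  {χ : Multiplicative Q →* C}

/-! ### Ideals generated by chart elements are `A`-spans of chart elements -/

/-- A `C`-ideal generated by chart elements `χ(T)`, `T ⊆ Q`, lies in the `A`-span of `χ(T + Q)`
(`C` being the `A`-span of `χ(Q)`). [folklore] -/
theorem mem_span_image_add_of_mem_ideal_span (hgen : Algebra.adjoin A (Set.range χ) = ⊤)
    (T : Set Q) {x : C} (hx : x ∈ Ideal.span ((fun q : Q => χ (Multiplicative.ofAdd q)) '' T)) :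
    x ∈ Submodule.span A ((fun q : Q => χ (Multiplicative.ofAdd q)) ''
      {t : Q | ∃ s ∈ T, ∃ q' : Q, t = s + q'}) := by
  induction hx using Submodule.span_induction with
  | mem z hz =>
    obtain ⟨s, hs, rfl⟩ := hz
    exact Submodule.subset_span ⟨s + 0, ⟨s, hs, 0, rfl⟩, by rw [add_zero]⟩
  | zero => exact Submodule.zero_mem _
  | add x y _ _ hx hy => exact Submodule.add_mem _ hx hy
  | smul c x _ hx =>
    have hc := mem_span_range_of_adjoin_eq_top hgen c
    have h := Submodule.mul_mem_mul hc hx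
    rw [Submodule.span_mul_span] at h
    rw [smul_eq_mul]
    refine Submodule.span_mono ?_ h
    rintro _ ⟨_, ⟨q₁, rfl⟩, _, ⟨t, ⟨s, hs, q', rfl⟩, rfl⟩, rfl⟩
    refine ⟨s + (q' + Multiplicative.toAdd q₁), ⟨s, hs, q' + Multiplicative.toAdd q₁, rfl⟩, ?_⟩
    change χ (Multiplicative.ofAdd (s + (q' + Multiplicative.toAdd q₁))) =
      χ q₁ * χ (Multiplicative.ofAdd (s + q'))
    rw [ofAdd_add, ofAdd_add, ofAdd_add, map_mul, map_mul, map_mul, ofAdd_toAdd]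
    ring

/-- **Transfer, general-set form.** Under (D), every `y` in the `A`-span of `χ(T)` (`T ⊆ Q`) satisfies
`φ(p₀)·y = (image of a)` for some `p₀ ∈ P` and `a` in the monomial ideal `(φ(w) : w ∈ W)` of `A`,
`W ⊆ P` finite with `W ⊆ T + p₀`. [folklore] -/
theorem exists_finset_mul_eq_algebraMap_of_mem_span_image (hPQ : P ≤ Q)
    (hχ : ∀ p : P, χ (Multiplicative.ofAdd ⟨(p : Fin n → ℤ), hPQ p.2⟩) =
      algebraMap A C (φ (Multiplicative.ofAdd p)))
    (hD : ∀ q ∈ Q, ∃ p ∈ P, q + p ∈ P) (T : Set Q) {y : C}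
    (hy : y ∈ Submodule.span A ((fun q : Q => χ (Multiplicative.ofAdd q)) '' T)) :
    ∃ (p₀ : P) (W : Finset P), (∀ w ∈ W, ∃ t ∈ T, (w : Fin n → ℤ) = (t : Fin n → ℤ) + p₀) ∧
      ∃ a ∈ Ideal.span ((fun w : P => φ (Multiplicative.ofAdd w)) '' (W : Set P)),
        algebraMap A C (φ (Multiplicative.ofAdd p₀)) * y = algebraMap A C a := by
  classical
  induction hy using Submodule.span_induction with
  | mem z hz =>
    obtain ⟨q, hq, rfl⟩ := hz
    obtain ⟨p, hp, hqp⟩ := hD _ q.2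
    refine ⟨⟨p, hp⟩, {⟨(q : Fin n → ℤ) + p, hqp⟩}, ?_, φ (Multiplicative.ofAdd ⟨(q : Fin n → ℤ) + p, hqp⟩),
      Ideal.subset_span ⟨_, by simp, rfl⟩, ?_⟩
    · intro w hw
      rw [Finset.mem_singleton] at hw
      subst hw
      exact ⟨q, hq, rfl⟩
    · rw [← val_of_mem P φ hp, ← chi_mk_eq_algebraMap_val hPQ hχ hp, ← val_of_mem P φ hqp,
        ← chi_mk_eq_algebraMap_val hPQ hχ hqp, mul_comm, ← chi_mk_add q.2 (hPQ hp)]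
  | zero =>
    exact ⟨0, ∅, by simp, 0, Ideal.zero_mem _, by rw [mul_zero, map_zero]⟩
  | add x y _ _ hx hy =>
    obtain ⟨p₀, W, hW, a, ha, hxe⟩ := hx
    obtain ⟨p₁, W', hW', a', ha', hye⟩ := hy
    refine ⟨p₀ + p₁, W.image (· + p₁) ∪ W'.image (· + p₀), ?_,
      φ (Multiplicative.ofAdd p₁) * a + φ (Multiplicative.ofAdd p₀) * a', ?_, ?_⟩
    · intro w hw
      rcases Finset.mem_union.1 hw with hw | hw
      · obtain ⟨w₀, hw₀, rfl⟩ := Finset.mem_image.1 hw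
        obtain ⟨t, ht, hte⟩ := hW w₀ hw₀
        refine ⟨t, ht, ?_⟩
        push_cast; rw [hte]; abel
      · obtain ⟨w₀, hw₀, rfl⟩ := Finset.mem_image.1 hw
        obtain ⟨t, ht, hte⟩ := hW' w₀ hw₀
        refine ⟨t, ht, ?_⟩
        push_cast; rw [hte]; abel
    · refine Ideal.add_mem _ ?_ ?_
      · refine Ideal.span_mono ?_ (mul_mem_span_image_add ha p₁)
        exact Set.image_mono fun w hw => Finset.mem_union_left _ hw
      · refine Ideal.span_mono ?_ (mul_mem_span_image_add ha' p₀)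
        exact Set.image_mono fun w hw => Finset.mem_union_right _ hw
    · rw [ofAdd_add, map_mul, map_mul, mul_add,
        show algebraMap A C (φ (Multiplicative.ofAdd p₀)) * algebraMap A C (φ (Multiplicative.ofAdd p₁)) * x
          = algebraMap A C (φ (Multiplicative.ofAdd p₁)) * (algebraMap A C (φ (Multiplicative.ofAdd p₀)) * x)
          by ring, hxe,
        show algebraMap A C (φ (Multiplicative.ofAdd p₀)) * algebraMap A C (φ (Multiplicative.ofAdd p₁)) * y
          = algebraMap A C (φ (Multiplicative.ofAdd p₀)) * (algebraMap A C (φ (Multiplicative.ofAdd p₁)) * y)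
          by ring, hye, map_add, map_mul, map_mul]
  | smul r x _ hx =>
    obtain ⟨p₀, W, hW, a, ha, hxe⟩ := hx
    refine ⟨p₀, W, hW, r * a, Ideal.mul_mem_left _ _ ha, ?_⟩
    rw [Algebra.smul_def, mul_left_comm, hxe, map_mul]

/-! ### Monomial membership at the fixed prime -/

/-- Monomial membership up to a unit, in the base: if `φ(p')·a ∈ (φ(w) : w ∈ W)` with `a ∉ 𝔭`
then `p' − w − s ∈ ℤF_𝔭` for some `w ∈ W`, `s ∈ P` (log regularity at `𝔭`,
`LogChart.exists_sub_sub_mem_span_faceMonoid_of_mem_span`). [cite: Kato1994, (6.1)] -/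
theorem exists_sub_sub_mem_span_of_mul_mem_span [IsNoetherianRing A] (hP : P.FG)
    (hsat : ∀ (v : Fin n → ℤ) (k : ℕ), 0 < k → k • v ∈ P → v ∈ P) (hreg : IsLogRegularAt P φ 𝔭)
    {a : A} (ha : a ∉ 𝔭) (p' : P) (W : Finset P)
    (hmem : φ (Multiplicative.ofAdd p') * a ∈
      Ideal.span ((fun w : P => φ (Multiplicative.ofAdd w)) '' (W : Set P))) :
    ∃ w ∈ W, ∃ s : P, (p' : Fin n → ℤ) - w - s ∈ Submodule.span ℤ (faceMonoid P φ 𝔭 : Set (Fin n → ℤ)) := by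
  have hua : IsUnit (algebraMap A (Localization.AtPrime 𝔭) a) :=
    IsLocalization.map_units (Localization.AtPrime 𝔭) (⟨a, ha⟩ : 𝔭.primeCompl)
  have hloc : algebraMap A (Localization.AtPrime 𝔭) (φ (Multiplicative.ofAdd p')) ∈
      Ideal.span ((fun q : P => algebraMap A (Localization.AtPrime 𝔭) (φ (Multiplicative.ofAdd q))) ''
        (W : Set P)) := by
    have h1 := Ideal.mem_map_of_mem (algebraMap A (Localization.AtPrime 𝔭)) hmem
    rw [Ideal.map_span, ← Set.image_comp, map_mul] at h1
    have h2 := Ideal.mul_mem_right (↑hua.unit⁻¹ : Localization.AtPrime 𝔭) _ h1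
    rwa [mul_assoc, IsUnit.mul_val_inv, mul_one] at h2
  exact exists_sub_sub_mem_span_faceMonoid_of_mem_span hP hsat hreg p' W hloc

/-- **Monomial ideal membership is combinatorial at the torus-fixed point.** Let `φ : P → A`
(`P ⊆ ℤⁿ` finitely generated, saturated; `A` Noetherian) be log regular at `𝔭`, `L = ℤF_𝔭`, and let
`C = A[χ(Q)]` be a chart algebra over it with (D), (K), (S); let `𝔓` be a prime of `C` over `𝔭`
containing `χ(Q ∖ L)`. If `q ∈ Q`, `W ⊆ Q` and `χ(q) ∈ (χ(w) : w ∈ W)·C_𝔓`, then `q − w − s ∈ L`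
for some `w ∈ W` and `s ∈ Q`. [cite: Kato1994, (6.1), (10.1)] [cite: Niziol2006, Lemma 2.4] -/
theorem exists_sub_sub_mem_span_of_mem_span_fixedPrime [IsNoetherianRing A] (hP : P.FG)
    (hsat : ∀ (v : Fin n → ℤ) (k : ℕ), 0 < k → k • v ∈ P → v ∈ P) (hreg : IsLogRegularAt P φ 𝔭)
    (hPQ : P ≤ Q)
    (hχ : ∀ p : P, χ (Multiplicative.ofAdd ⟨(p : Fin n → ℤ), hPQ p.2⟩) =
      algebraMap A C (φ (Multiplicative.ofAdd p)))
    (hgen : Algebra.adjoin A (Set.range χ) = ⊤)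
    (hD : ∀ q ∈ Q, ∃ p ∈ P, q + p ∈ P)
    (hK : ∀ a : A, algebraMap A C a = 0 → ∃ p : P, φ (Multiplicative.ofAdd p) * a = 0)
    (hS : ∀ q₁ ∈ Q, ∀ q₂ ∈ Q, q₁ + q₂ ∈ Submodule.span ℤ (faceMonoid P φ 𝔭 : Set (Fin n → ℤ)) →
      q₁ ∈ Submodule.span ℤ (faceMonoid P φ 𝔭 : Set (Fin n → ℤ)))
    {𝔓 : Ideal C} [𝔓.IsPrime] (h𝔓 : 𝔓.comap (algebraMap A C) = 𝔭)
    (hq : ∀ q : Q, (q : Fin n → ℤ) ∉ Submodule.span ℤ (faceMonoid P φ 𝔭 : Set (Fin n → ℤ)) →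
      χ (Multiplicative.ofAdd q) ∈ 𝔓)
    (q : Q) (W : Set Q)
    (h : algebraMap C (Localization.AtPrime 𝔓) (χ (Multiplicative.ofAdd q)) ∈
      Ideal.span ((fun w : Q => algebraMap C (Localization.AtPrime 𝔓) (χ (Multiplicative.ofAdd w))) '' W)) :
    ∃ w ∈ W, ∃ s : Q, (q : Fin n → ℤ) - w - s ∈ Submodule.span ℤ (faceMonoid P φ 𝔭 : Set (Fin n → ℤ)) := by
  classical
  -- Step 1: clear the denominator
  have h1 : algebraMap C (Localization.AtPrime 𝔓) (χ (Multiplicative.ofAdd q)) ∈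
      (Ideal.span ((fun w : Q => χ (Multiplicative.ofAdd w)) '' W)).map
        (algebraMap C (Localization.AtPrime 𝔓)) := by
    rw [Ideal.map_span, ← Set.image_comp]; exact h
  obtain ⟨u, hu, huq⟩ := (IsLocalization.algebraMap_mem_map_algebraMap_iff 𝔓.primeCompl
    (Localization.AtPrime 𝔓) _ _).1 h1
  have hu𝔓 : u ∉ 𝔓 := hu
  -- Step 2: normal form of `u`, with `a ∉ 𝔭`
  obtain ⟨f, hf, a, y, hy, hue⟩ := exists_val_mul_eq_add (𝔭 := 𝔭) hPQ hχ hgen u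
  have hJ𝔓 : Ideal.span ((algebraMap A C '' (𝔭 : Set A)) ∪ ((fun q : Q => χ (Multiplicative.ofAdd q)) ''
      {q : Q | (q : Fin n → ℤ) ∉ Submodule.span ℤ (faceMonoid P φ 𝔭 : Set (Fin n → ℤ))})) ≤ 𝔓 := by
    refine Ideal.span_le.2 ?_
    rintro _ (⟨π, hπ, rfl⟩ | ⟨q', hq', rfl⟩)
    · have : π ∈ 𝔓.comap (algebraMap A C) := by rw [h𝔓]; exact hπ
      exact this
    · exact hq q' hq'
  have hNJ : Submodule.span A ((fun q : Q => χ (Multiplicative.ofAdd q)) '' {q : Q | (q : Fin n → ℤ) ∉ Submodule.span ℤ (faceMonoid P φ 𝔭 : Set (Fin n → ℤ))}) ≤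
      𝔓.restrictScalars A :=
    Submodule.span_le.2 fun z hz => hJ𝔓 (Ideal.subset_span (Or.inr hz))
  have ha𝔭 : a ∉ 𝔭 := by
    intro ha
    apply hu𝔓
    have h2 : algebraMap A C (val P φ f) * u ∈ 𝔓 := by
      rw [hue]
      refine 𝔓.add_mem ?_ (hNJ hy)
      have : a ∈ 𝔓.comap (algebraMap A C) := by rw [h𝔓]; exact ha
      exact this
    refine (Ideal.IsPrime.mem_or_mem ‹_› h2).resolve_left ?_
    intro hf𝔓
    have : val P φ f ∈ 𝔓.comap (algebraMap A C) := hf𝔓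
    rw [h𝔓] at this
    exact hf.2 this
  -- Step 3: `a χ(q)` lies in the ideal generated by `χ(W ∪ (q + (Q ∖ L)))`
  set S : Set Q := W ∪ {q'' : Q | ∃ q' : Q, (q' : Fin n → ℤ) ∉ Submodule.span ℤ (faceMonoid P φ 𝔭 : Set (Fin n → ℤ)) ∧ q'' = q + q'} with hSdef
  have h3 : algebraMap A C a * χ (Multiplicative.ofAdd q) ∈
      Ideal.span ((fun w : Q => χ (Multiplicative.ofAdd w)) '' S) := by
    have e1 : algebraMap A C a * χ (Multiplicative.ofAdd q) =
        algebraMap A C (val P φ f) * (u * χ (Multiplicative.ofAdd q)) - y * χ (Multiplicative.ofAdd q) := by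
      rw [← mul_assoc, hue]; ring
    rw [e1]
    refine Ideal.sub_mem _ (Ideal.mul_mem_left _ _ (Ideal.span_mono (Set.image_mono
      Set.subset_union_left) huq)) ?_
    -- `y χ(q)` with `y ∈ N`
    have hN : ∀ z ∈ Submodule.span A ((fun q : Q => χ (Multiplicative.ofAdd q)) '' {q : Q | (q : Fin n → ℤ) ∉ Submodule.span ℤ (faceMonoid P φ 𝔭 : Set (Fin n → ℤ))}),
        z * χ (Multiplicative.ofAdd q) ∈ Submodule.span A ((fun w : Q => χ (Multiplicative.ofAdd w)) '' S) := by
      intro z hz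
      induction hz using Submodule.span_induction with
      | mem z hz =>
        obtain ⟨q', hq', rfl⟩ := hz
        refine Submodule.subset_span ⟨q + q', Or.inr ⟨q', hq', rfl⟩, ?_⟩
        change χ (Multiplicative.ofAdd (q + q')) = χ (Multiplicative.ofAdd q') * χ (Multiplicative.ofAdd q)
        rw [ofAdd_add, map_mul, mul_comm]
      | zero => rw [zero_mul]; exact Submodule.zero_mem _
      | add x y _ _ hx hy => rw [add_mul]; exact Submodule.add_mem _ hx hy
      | smul r x _ hx => rw [Algebra.smul_mul_assoc]; exact Submodule.smul_mem _ _ hx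
    have hy' := hN y hy
    exact (Submodule.span_le.2 fun z hz => Ideal.subset_span hz :
      Submodule.span A ((fun w : Q => χ (Multiplicative.ofAdd w)) '' S) ≤
        (Ideal.span ((fun w : Q => χ (Multiplicative.ofAdd w)) '' S)).restrictScalars A) hy'
  -- Step 4: transfer to `A`
  have h4 := mem_span_image_add_of_mem_ideal_span hgen S h3
  obtain ⟨p₀, W', hW', a', ha', hEq⟩ := exists_finset_mul_eq_algebraMap_of_mem_span_image hPQ hχ hD _ h4
  obtain ⟨pq, hpq, hqpq⟩ := hD _ q.2
  -- `φ(p₀) a φ(q + pq) ↦ φ(pq) a'`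
  have hzero : algebraMap A C (φ (Multiplicative.ofAdd p₀) * a *
      φ (Multiplicative.ofAdd ⟨(q : Fin n → ℤ) + pq, hqpq⟩) - φ (Multiplicative.ofAdd ⟨pq, hpq⟩) * a') = 0 := by
    rw [map_sub, map_mul, map_mul, map_mul, ← hEq, ← hχ ⟨(q : Fin n → ℤ) + pq, hqpq⟩, ← hχ ⟨pq, hpq⟩,
      chi_mk_add q.2 (hPQ hpq)]
    change _ * (χ (Multiplicative.ofAdd q) * _) - _ = (0 : C)
    ring
  obtain ⟨p, hp⟩ := hK _ hzero
  have hrel : φ (Multiplicative.ofAdd (p + p₀ + ⟨(q : Fin n → ℤ) + pq, hqpq⟩)) * a =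
      φ (Multiplicative.ofAdd (⟨pq, hpq⟩ + p)) * a' := by
    have h1' : φ (Multiplicative.ofAdd p) * (φ (Multiplicative.ofAdd p₀) * a *
        φ (Multiplicative.ofAdd ⟨(q : Fin n → ℤ) + pq, hqpq⟩)) -
        φ (Multiplicative.ofAdd p) * (φ (Multiplicative.ofAdd ⟨pq, hpq⟩) * a') = 0 := by
      rw [← mul_sub]; exact hp
    have h2' := sub_eq_zero.1 h1'
    rw [ofAdd_add, ofAdd_add, map_mul, map_mul, ofAdd_add, map_mul]
    calc φ (Multiplicative.ofAdd p) * φ (Multiplicative.ofAdd p₀) *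
          φ (Multiplicative.ofAdd ⟨(q : Fin n → ℤ) + pq, hqpq⟩) * a
        = φ (Multiplicative.ofAdd p) * (φ (Multiplicative.ofAdd p₀) * a *
            φ (Multiplicative.ofAdd ⟨(q : Fin n → ℤ) + pq, hqpq⟩)) := by ring
      _ = φ (Multiplicative.ofAdd p) * (φ (Multiplicative.ofAdd ⟨pq, hpq⟩) * a') := h2'
      _ = φ (Multiplicative.ofAdd ⟨pq, hpq⟩) * φ (Multiplicative.ofAdd p) * a' := by ring
  have hmem : φ (Multiplicative.ofAdd (p + p₀ + ⟨(q : Fin n → ℤ) + pq, hqpq⟩)) * a ∈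
      Ideal.span ((fun w : P => φ (Multiplicative.ofAdd w)) ''
        ((W'.image (· + (⟨pq, hpq⟩ + p)) : Finset P) : Set P)) := by
    rw [hrel]; exact mul_mem_span_image_add ha' _
  obtain ⟨w'', hw'', s, hs⟩ := exists_sub_sub_mem_span_of_mul_mem_span hP hsat hreg ha𝔭 _ _ hmem
  obtain ⟨w', hw', rfl⟩ := Finset.mem_image.1 hw''
  obtain ⟨t, ht, hte⟩ := hW' w' hw'
  obtain ⟨s₀, hs₀, q', rfl⟩ := ht
  -- `q − s₀ − q' − s ∈ L`
  have hkey : (q : Fin n → ℤ) - s₀ - ((q' : Fin n → ℤ) + s) ∈ Submodule.span ℤ (faceMonoid P φ 𝔭 : Set (Fin n → ℤ)) := by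
    have e : ((p + p₀ + ⟨(q : Fin n → ℤ) + pq, hqpq⟩ : P) : Fin n → ℤ) - ↑(w' + (⟨pq, hpq⟩ + p)) - ↑s =
        (q : Fin n → ℤ) - s₀ - ((q' : Fin n → ℤ) + s) := by
      push_cast; rw [hte]; push_cast; abel
    rw [← e]; exact hs
  rcases hs₀ with hs₀W | ⟨q₁, hq₁L, rfl⟩
  · exact ⟨s₀, hs₀W, ⟨(q' : Fin n → ℤ) + s, Q.add_mem q'.2 (hPQ s.2)⟩, hkey⟩
  · exfalso
    apply hq₁L
    refine hS _ q₁.2 ((q' : Fin n → ℤ) + s) (Q.add_mem q'.2 (hPQ s.2)) ?_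
    have e : (q₁ : Fin n → ℤ) + ((q' : Fin n → ℤ) + s) =
        -((q : Fin n → ℤ) - ↑(q + q₁) - ((q' : Fin n → ℤ) + s)) := by
      push_cast; abel
    rw [e]
    exact Submodule.neg_mem _ hkey

end Summit.ResolutionOfSingularities.ResolutionOfSingularities.Theorems.FRationalResolution.ChartAlgebraFixedPointMembership

end
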